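import Summits.BirchSwinnertonDyer.BirchSwinnertonDyer.Theorems.SylvesterTwoHeegnerIndexCoupledTelescopeCebotarevKernelPairSylvester
import HarnessLib

/-!
# The COUPLED Cassels–Tate telescope, XLVI: the rows' ADMISSIBLE SETS as `𝒪`-LINES OF `σ`-EIGENCLASSES, their
# memberships, and the (T-L3) TRANSFER (RESIDUE c v3 l.81–85, l.171–188; crux `UpperOffV0HSYPlus`,
# stmt-BirchSwinnertonDyer-19804; plan (B) SIGNS file B-V, planner D774/D785)

RESIDUE 4 v3 lets the rows CHOOSE one admissible set `Adm_X ⊆ H¹(K, X_K[4^κ])` per curve, subject to: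
`0 ∈ Adm_X`, `res (Sel(X/ℚ)) ⊆ Adm_X`, the Kolyvagin classes `c_X(n) ∈ Adm_X`, `c_B(1) = 2^{M₀} • δ x₀ ∈ Adm_B`,
and the MIXED Čebotarev clause (T-L3) for all finite `T_X ⊆ Adm_X`, `g_X ∈ Adm_X`.  The tree proves (T-L3) for
the σ-EIGENCLASSES `{x | ∃ ε, σ_* x = ε • x}` (`cebotarev_kernelForm_sylvesterPair`, XXIII), but the rows'
classes are only eigen UP TO A UNIT of `𝒪 = ℤ[ω]` acting through `w_X = H¹([ω])`: Gross's Prop. 5.4 in the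
CM frame gives `σ_* c_X(n) = ± w_X^j c_X(n)` (files B-III/B-IV), and `c_B(1)` is `n⁻¹(a + b ω) • δ P♯`
with `n` odd, `a, b` not both even, `P♯` rational ((T6)).  THIS file therefore takes
  `Adm_X := {x | ∃ y, (∃ ε, σ_* y = ε • y) ∧ x ∈ closure {y, w_X y} ∧ y ∈ closure {x, w_X x}}`
(the `𝒪`-line of `x` is the `𝒪`-line of an eigenclass) and proves, as pure `ℤ[ω]`-module algebra over an
abelian group `S` with an additive `w`, `w (w x) + w x + x = 0`:
* `closure_union_image_le_closure/_eq`, `insert_insert_union_image_eq` — the small/big closures of (T-L3) are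
  `𝒪`-spans, so they only depend on the `𝒪`-lines of the generators;
* `kernelForm_of_partners` — the KERNEL FORM for `(g, T)` follows from the kernel form for eigen partners
  `(y, T')` with the same lines; `exists_partners_finset` — partners for a finite family;
* memberships: `mem_admLines_of_eigen` (eigenclasses, so `0` and `res`), `mem_admLines_of_eigen_iterate`
  (`w^j x` eigen ⇒ `x ∈ Adm`, `w³ = 1`), `mem_admLines_of_odd_zsmul_eq` (`n • x = a • y + b • w y`, `n` odd,
  `a, b` not both even, `y` eigen ⇒ `x ∈ Adm`: `2` is inert in `ℤ[ω]`, the norm `a² − ab + b²` is odd);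
and then, at the display's currency (binders VERBATIM as in XXIII):
* ★ `cebotarev_kernelForm_sylvesterPair_lines` — RESIDUE (T-L3) for THESE `Adm_X` (one call of XXIII on the
  partners); `zero_mem_admLines`, `resTorsion_mem_admLines`, `zsmul_mem_admSet` — l.83–85 and the eigen input
  of `c_B(1)`.
Theorems only (no definition / named fact / instance / notation); nothing asserted on 19804; no stub closed;
X12.CMAtTwo NOT proved; BSD not claimed for any curve.  Sources: [GrossLMS1991] §5 (5.1), Prop. 5.4;
[McCallumLMS1991] §3, §5 Thm. 5.4; [IrelandRosen1990] Ch. 9 §1 (`ℤ[ω]`, `2` inert).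
`lean search 'kernelForm_of_partners|admLines'` → nothing before this file.
-/

-- every Summits module is named `Summit.<Summit>.<Problem>…`: the duplicated component is by design
set_option linter.dupNamespace false
set_option autoImplicit false

noncomputable section

open scoped Classical
open WeierstrassCurve NumberField IsDedekindDomain Field
open Literature.NumberTheory.EllipticCurves Literature.NumberTheory.GaloisRepresentations
  Literature.NumberTheory.EllipticCurves.HuShuYin2019

namespace Summit.BirchSwinnertonDyer.BirchSwinnertonDyer.Theorems.SylvesterTwoCoupledTelescope

open SylvesterTwoCoupledDescentCebotarev SylvesterTwoCoupledDescentF4Package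

/-! ## §1 `ℤ[ω]`-lines in an abelian group with `w² + w + 1 = 0` -/

section Lines

variable {S : Type*} [AddCommGroup S] (w : S →+ S)

/-- `{y, w y} = {y} ∪ w '' {y}` (the `𝒪`-line generators in the (T-L3) union-image shape). [folklore] -/
theorem pair_eq_singleton_union_image (y : S) : ({y, w y} : Set S) = {y} ∪ w '' {y} := by
  rw [Set.image_singleton, Set.singleton_union]

/-- The big closure's generating set of (T-L3) is a union-image: `{g, w g} ∪ (T ∪ w T) = (g ∪ T) ∪ w (g ∪ T)`.
[folklore] -/
theorem insert_insert_union_image_eq (g : S) (T : Set S) :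
    insert g (insert (w g) (T ∪ w '' T)) = insert g T ∪ w '' insert g T := by
  rw [Set.image_insert_eq, Set.insert_union, Set.union_insert]

/-- **`𝒪`-spans are monotone in `𝒪`-spans**: `closure (U ∪ w U) ≤ closure (V ∪ w V)` once
`U ⊆ closure (V ∪ w V)` (the latter is `w`-stable, `map_mem_closure_union_image`). [folklore] -/
theorem closure_union_image_le_closure (hw : ∀ x, w (w x) + w x + x = 0) {U V : Set S}
    (h : U ⊆ AddSubgroup.closure (V ∪ w '' V)) :
    AddSubgroup.closure (U ∪ w '' U) ≤ AddSubgroup.closure (V ∪ w '' V) := by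
  rw [AddSubgroup.closure_le]
  rintro x (hx | ⟨u, hu, rfl⟩)
  · exact h hx
  · exact map_mem_closure_union_image w hw V (h hu)

/-- Two generating sets inside each other's `𝒪`-span have the same `𝒪`-span. [folklore] -/
theorem closure_union_image_eq (hw : ∀ x, w (w x) + w x + x = 0) {U V : Set S}
    (hUV : U ⊆ AddSubgroup.closure (V ∪ w '' V)) (hVU : V ⊆ AddSubgroup.closure (U ∪ w '' U)) :
    AddSubgroup.closure (U ∪ w '' U) = AddSubgroup.closure (V ∪ w '' V) :=
  le_antisymm (closure_union_image_le_closure w hw hUV) (closure_union_image_le_closure w hw hVU)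

/-- `x ∈ 𝒪 x`. [folklore] -/
theorem mem_closure_pair_self (x : S) : x ∈ AddSubgroup.closure ({x, w x} : Set S) :=
  AddSubgroup.subset_closure (Set.mem_insert _ _)

/-- `w x ∈ 𝒪 x`. [folklore] -/
theorem map_mem_closure_pair_self (x : S) : w x ∈ AddSubgroup.closure ({x, w x} : Set S) :=
  AddSubgroup.subset_closure (Set.mem_insert_of_mem _ (Set.mem_singleton _))

/-- `𝒪 x` is `w`-stable. [folklore] -/
theorem map_mem_closure_pair (hw : ∀ x, w (w x) + w x + x = 0) {x y : S}
    (h : x ∈ AddSubgroup.closure ({y, w y} : Set S)) : w x ∈ AddSubgroup.closure ({y, w y} : Set S) := by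
  rw [pair_eq_singleton_union_image] at h ⊢
  exact map_mem_closure_union_image w hw _ h

/-- `𝒪 y ≤ closure (V ∪ w V)` once `y` lies in the latter. [folklore] -/
theorem closure_pair_le_of_mem_closure (hw : ∀ x, w (w x) + w x + x = 0) {y : S} {V : Set S}
    (hy : y ∈ AddSubgroup.closure (V ∪ w '' V)) :
    AddSubgroup.closure ({y, w y} : Set S) ≤ AddSubgroup.closure (V ∪ w '' V) := by
  rw [pair_eq_singleton_union_image]
  exact closure_union_image_le_closure w hw (Set.singleton_subset_iff.mpr hy)

/-- `𝒪 y ≤ closure (V ∪ w V)` for `y ∈ V`. [folklore] -/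
theorem closure_pair_le_of_mem (hw : ∀ x, w (w x) + w x + x = 0) {y : S} {V : Set S} (hy : y ∈ V) :
    AddSubgroup.closure ({y, w y} : Set S) ≤ AddSubgroup.closure (V ∪ w '' V) :=
  closure_pair_le_of_mem_closure w hw (AddSubgroup.subset_closure (Or.inl hy))

/-- `𝒪 x ≤ 𝒪 y` once `x ∈ 𝒪 y`. [folklore] -/
theorem closure_pair_le (hw : ∀ x, w (w x) + w x + x = 0) {x y : S}
    (h : x ∈ AddSubgroup.closure ({y, w y} : Set S)) :
    AddSubgroup.closure ({x, w x} : Set S) ≤ AddSubgroup.closure ({y, w y} : Set S) := by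
  have h' : x ∈ AddSubgroup.closure ({y} ∪ w '' {y}) := by rwa [← pair_eq_singleton_union_image]
  have := closure_pair_le_of_mem_closure w hw h'
  rwa [← pair_eq_singleton_union_image] at this

/-- **The (T-L3) TRANSFER.**  If `g` and `y` span the same `𝒪`-line and the families `T`, `T'` span the same
`𝒪`-module, the KERNEL FORM «on `closure ({y, w y} ∪ T' ∪ w T')`, `Loc ⟺ ∈ closure (T' ∪ w T')`» for `(y, T')`
IS the kernel form for `(g, T)` (both closures coincide). [cite: McCallumLMS1991, §5 Thm. 5.4 (proof)] -/
theorem kernelForm_of_partners (hw : ∀ x, w (w x) + w x + x = 0) (Loc : S → Prop) {g y : S} {T T' : Set S}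
    (hgy : g ∈ AddSubgroup.closure ({y, w y} : Set S)) (hyg : y ∈ AddSubgroup.closure ({g, w g} : Set S))
    (hTT' : T ⊆ AddSubgroup.closure (T' ∪ w '' T')) (hT'T : T' ⊆ AddSubgroup.closure (T ∪ w '' T))
    (h : ∀ x ∈ AddSubgroup.closure (insert y (insert (w y) (T' ∪ w '' T'))),
      Loc x ↔ x ∈ AddSubgroup.closure (T' ∪ w '' T')) :
    ∀ x ∈ AddSubgroup.closure (insert g (insert (w g) (T ∪ w '' T))),
      Loc x ↔ x ∈ AddSubgroup.closure (T ∪ w '' T) := by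
  have hsmall : AddSubgroup.closure (T ∪ w '' T) = AddSubgroup.closure (T' ∪ w '' T') :=
    closure_union_image_eq w hw hTT' hT'T
  have hmono : ∀ (z : S) (U : Set S), AddSubgroup.closure (U ∪ w '' U) ≤
      AddSubgroup.closure (insert z U ∪ w '' insert z U) := fun z U ↦
    AddSubgroup.closure_mono (Set.union_subset_union (Set.subset_insert _ _)
      (Set.image_mono (Set.subset_insert _ _)))
  have hbig : AddSubgroup.closure (insert g (insert (w g) (T ∪ w '' T))) =
      AddSubgroup.closure (insert y (insert (w y) (T' ∪ w '' T'))) := by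
    rw [insert_insert_union_image_eq, insert_insert_union_image_eq]
    refine closure_union_image_eq w hw ?_ ?_
    · rintro x (rfl | hx)
      · exact closure_pair_le_of_mem w hw (Set.mem_insert y T') hgy
      · exact hmono y T' (hTT' hx)
    · rintro x (rfl | hx)
      · exact closure_pair_le_of_mem w hw (Set.mem_insert g T) hyg
      · exact hmono g T (hT'T hx)
  intro x hx
  rw [hbig] at hx
  rw [hsmall]
  exact h x hx

/-- **Eigen partners for a finite family**: if every `t ∈ T` spans the `𝒪`-line of some `y` with `E y`,
some finite `T'` of `E`-elements spans the same `𝒪`-module as `T`. [folklore] -/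
theorem exists_partners_finset (hw : ∀ x, w (w x) + w x + x = 0) (E : S → Prop) (T : Finset S)
    (hT : ∀ t ∈ T, ∃ y, E y ∧ t ∈ AddSubgroup.closure ({y, w y} : Set S) ∧
      y ∈ AddSubgroup.closure ({t, w t} : Set S)) :
    ∃ T' : Finset S, (∀ y ∈ T', E y) ∧ (↑T : Set S) ⊆ AddSubgroup.closure (↑T' ∪ w '' ↑T') ∧
      (↑T' : Set S) ⊆ AddSubgroup.closure (↑T ∪ w '' ↑T) := by
  choose! e he using hT
  refine ⟨T.image e, ?_, ?_, ?_⟩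
  · intro y hy
    obtain ⟨t, ht, rfl⟩ := Finset.mem_image.mp hy
    exact (he t ht).1
  · intro t ht
    have ht' : t ∈ T := Finset.mem_coe.mp ht
    exact closure_pair_le_of_mem w hw (V := (↑(T.image e) : Set S))
      (Finset.mem_coe.mpr (Finset.mem_image_of_mem e ht')) (he t ht').2.1
  · intro y hy
    obtain ⟨t, ht, rfl⟩ := Finset.mem_image.mp (Finset.mem_coe.mp hy)
    exact closure_pair_le_of_mem w hw (V := (↑T : Set S)) (Finset.mem_coe.mpr ht) (he t ht).2.2

/-! ### Memberships in `Adm := {x | ∃ y, E y ∧ x ∈ 𝒪 y ∧ y ∈ 𝒪 x}` -/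

/-- An `E`-element is admissible (its own partner). [folklore] -/
theorem mem_admLines_of_eigen {E : S → Prop} {x : S} (hx : E x) :
    ∃ y, E y ∧ x ∈ AddSubgroup.closure ({y, w y} : Set S) ∧ y ∈ AddSubgroup.closure ({x, w x} : Set S) :=
  ⟨x, hx, mem_closure_pair_self w x, mem_closure_pair_self w x⟩

/-- `w³ = 1` from `w² + w + 1 = 0`. [folklore] -/
theorem map_map_map_eq_self (hw : ∀ x, w (w x) + w x + x = 0) (x : S) : w (w (w x)) = x := by
  have h1 : w (w x) = -(w x) - x := by
    have h := hw x
    rw [add_assoc, add_eq_zero_iff_eq_neg] at h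
    rw [h, neg_add']
  rw [h1, map_sub, map_neg, h1]
  abel

/-- `w^j x ∈ 𝒪 x`. [folklore] -/
theorem iterate_mem_closure_pair (hw : ∀ x, w (w x) + w x + x = 0) (j : ℕ) (x : S) :
    (w^[j]) x ∈ AddSubgroup.closure ({x, w x} : Set S) := by
  induction j with
  | zero => exact mem_closure_pair_self w x
  | succ j ih =>
    rw [Function.iterate_succ_apply']
    exact map_mem_closure_pair w hw ih

/-- `x ∈ 𝒪 (w^j x)` (`x = w^{2j} (w^j x)`, `w³ = 1`). [folklore] -/
theorem mem_closure_pair_iterate (hw : ∀ x, w (w x) + w x + x = 0) (j : ℕ) (x : S) :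
    x ∈ AddSubgroup.closure ({(w^[j]) x, w ((w^[j]) x)} : Set S) := by
  have h3 : (w^[3]) x = x := by
    show w (w (w x)) = x
    exact map_map_map_eq_self w hw x
  have hx : (w^[2 * j]) ((w^[j]) x) = x := by
    rw [← Function.iterate_add_apply, show 2 * j + j = 3 * j by ring, Function.iterate_mul]
    exact Function.iterate_fixed h3 j
  have h := iterate_mem_closure_pair w hw (2 * j) ((w^[j]) x)
  rwa [hx] at h

/-- **Classes eigen up to a power of `w` are admissible**: `E (w^j x) ⇒ x ∈ Adm` (partner `w^j x`).
This is how the Kolyvagin classes enter: Gross's Prop. 5.4 in the CM frame gives `σ_* c = ± w^j c`, and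
`w^{2j} c` is then an eigenclass. [cite: GrossLMS1991, Prop. 5.4] -/
theorem mem_admLines_of_eigen_iterate (hw : ∀ x, w (w x) + w x + x = 0) {E : S → Prop} {x : S} (j : ℕ)
    (hx : E ((w^[j]) x)) :
    ∃ y, E y ∧ x ∈ AddSubgroup.closure ({y, w y} : Set S) ∧ y ∈ AddSubgroup.closure ({x, w x} : Set S) :=
  ⟨(w^[j]) x, hx, mem_closure_pair_iterate w hw j x, iterate_mem_closure_pair w hw j x⟩

/-- `a, b` not both even ⇒ the norm `a² − ab + b²` is odd (`2` is inert in `ℤ[ω]`). [cite: IrelandRosen1990, Ch. 9 §1] -/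
theorem odd_norm_of_not_two_dvd {a b : ℤ} (h : ¬ (2 ∣ a ∧ 2 ∣ b)) : Odd (a * a - a * b + b * b) := by
  rw [← Int.not_even_iff_odd]
  rw [← even_iff_two_dvd, ← even_iff_two_dvd] at h
  simp only [Int.even_add, Int.even_sub, Int.even_mul]
  tauto

/-- An odd integer acts invertibly on a group killed by `N ∣ 2^m`. [folklore] -/
theorem exists_zsmul_zsmul_eq_self_of_odd (N m : ℕ) (hN : ∀ z : S, (N : ℤ) • z = 0) (hNm : N ∣ 2 ^ m)
    {n : ℤ} (hn : Odd n) : ∃ u : ℤ, ∀ z : S, u • (n • z) = z := by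
  have hM : ∀ z : S, ((2 : ℤ) ^ m) • z = 0 := fun z ↦ by
    obtain ⟨c, hc⟩ := hNm
    rw [show ((2 : ℤ) ^ m) = (c : ℤ) * (N : ℤ) by exact_mod_cast (mul_comm (N : ℕ) c ▸ hc :),
      mul_smul, hN, smul_zero]
  have hcop : IsCoprime n ((2 : ℤ) ^ m) := by
    obtain ⟨k, hk⟩ := hn
    exact (show IsCoprime n 2 from ⟨1, -k, by rw [hk]; ring⟩).pow_right
  obtain ⟨u, v, huv⟩ := hcop
  refine ⟨u, fun z ↦ ?_⟩
  calc u • (n • z) = (u * n + v * 2 ^ m) • z := by rw [add_smul, mul_smul, mul_smul, hM z, smul_zero, add_zero]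
    _ = z := by rw [huv, one_smul]

/-- **`𝒪`-lines with an odd-norm unit are admissible**: if `n • x = a • y + b • w y` with `n` odd, `a, b`
not both even and `E y`, then `x ∈ Adm` (partner `y`): `x = n⁻¹(a + bω) • y` and `y = N⁻¹ (a − b − bω) • (n • x)`,
`N = a² − ab + b²` odd, both inverses taken in `ℤ/2^m`.  This is how `c_B(1) = 2^{M₀} • δ x₀` enters ((T6)).
[cite: GrossLMS1991, §5 (5.1)] [cite: IrelandRosen1990, Ch. 9 §1] -/
theorem mem_admLines_of_odd_zsmul_eq (hw : ∀ x, w (w x) + w x + x = 0) (N m : ℕ)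
    (hN : ∀ z : S, (N : ℤ) • z = 0) (hNm : N ∣ 2 ^ m) {E : S → Prop} {x y : S} (hy : E y)
    {n a b : ℤ} (hn : Odd n) (hab : ¬ (2 ∣ a ∧ 2 ∣ b)) (h : n • x = a • y + b • w y) :
    ∃ y', E y' ∧ x ∈ AddSubgroup.closure ({y', w y'} : Set S) ∧ y' ∈ AddSubgroup.closure ({x, w x} : Set S) := by
  refine ⟨y, hy, ?_, ?_⟩
  · obtain ⟨u, hu⟩ := exists_zsmul_zsmul_eq_self_of_odd N m hN hNm hn
    rw [← hu x, h]
    exact AddSubgroup.zsmul_mem _ (add_mem (AddSubgroup.zsmul_mem _ (mem_closure_pair_self w y) _)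
      (AddSubgroup.zsmul_mem _ (map_mem_closure_pair_self w y) _)) _
  · obtain ⟨u, hu⟩ := exists_zsmul_zsmul_eq_self_of_odd N m hN hNm (odd_norm_of_not_two_dvd hab)
    have hNy : (a * a - a * b + b * b) • y ∈ AddSubgroup.closure ({x, w x} : Set S) := by
      rw [← conj_smul_pair_eq w hw y a b, ← h, map_zsmul]
      exact add_mem (AddSubgroup.zsmul_mem _ (AddSubgroup.zsmul_mem _ (mem_closure_pair_self w x) _) _)
        (AddSubgroup.zsmul_mem _ (AddSubgroup.zsmul_mem _ (map_mem_closure_pair_self w x) _) _)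
    rw [← hu y]
    exact AddSubgroup.zsmul_mem _ hNy _

end Lines

/-! ## §2 The rows' `Adm_X` at display currency -/

variable {K : Type} [Field K] [NumberField K]

/-- The σ-eigenclasses are stable under integer multiples (`σ_*` is additive). [folklore] -/
theorem zsmul_mem_admSet (X : WeierstrassCurve ℚ) (c : K ≃ₐ[ℚ] K) (n : ℤ) {x : galH1Torsion (X.baseChange K) n}
    (hx : x ∈ {x : galH1Torsion (X.baseChange K) n | ∃ ε : ℤ, conjAct X c n x = ε • x}) (k : ℤ) :
    k • x ∈ {x : galH1Torsion (X.baseChange K) n | ∃ ε : ℤ, conjAct X c n x = ε • x} := by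
  obtain ⟨ε, hε⟩ := hx
  exact ⟨ε, by rw [map_zsmul, hε, smul_comm]⟩

/-- `0 ∈ Adm_X` (lines version). [folklore] -/
theorem zero_mem_admLines (X : WeierstrassCurve ℚ) (c : K ≃ₐ[ℚ] K) (n : ℤ)
    (w : galH1Torsion (X.baseChange K) n →+ galH1Torsion (X.baseChange K) n) :
    (0 : galH1Torsion (X.baseChange K) n) ∈
      {x : galH1Torsion (X.baseChange K) n | ∃ y, (∃ ε : ℤ, conjAct X c n y = ε • y) ∧
        x ∈ AddSubgroup.closure ({y, w y} : Set _) ∧ y ∈ AddSubgroup.closure ({x, w x} : Set _)} :=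
  mem_admLines_of_eigen w (zero_mem_admSet X c n)

/-- **`res (H¹(ℚ, X[n])) ⊆ Adm_X`** (lines version; Gross 1991 (5.1)). [cite: GrossLMS1991, §5 (5.1)] -/
theorem resTorsion_mem_admLines {ω : K} (hω : ω ^ 2 + ω + 1 = 0) (h2 : Module.finrank ℚ K = 2)
    {c : K ≃ₐ[ℚ] K} (hcω : c ω = ω ^ 2) (X : WeierstrassCurve ℚ) (n : ℤ)
    (w : galH1Torsion (X.baseChange K) n →+ galH1Torsion (X.baseChange K) n) (u : galH1Torsion X n) :
    resTorsion X K n u ∈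
      {x : galH1Torsion (X.baseChange K) n | ∃ y, (∃ ε : ℤ, conjAct X c n y = ε • y) ∧
        x ∈ AddSubgroup.closure ({y, w y} : Set _) ∧ y ∈ AddSubgroup.closure ({x, w x} : Set _)} :=
  mem_admLines_of_eigen w (resTorsion_mem_admSet hω h2 hcω X n u)

set_option maxHeartbeats 800000 in
/-- ★ **RESIDUE c v3, clause (T-L3), for the rows' `Adm_X := 𝒪`-LINES OF σ-EIGENCLASSES and `Kol`** — binders and
conclusion VERBATIM as `cebotarev_kernelForm_sylvesterPair` (XXIII) with its eigenclass sets replaced by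
`{x | ∃ y, (∃ ε, σ_* y = ε • y) ∧ x ∈ closure {y, w_X y} ∧ y ∈ closure {x, w_X x}}`, `w_X = resH1Hom id fn_X hfn_X`.
Proof: eigen partners (`exists_partners_finset`), XXIII on the partners, `kernelForm_of_partners` twice.
[cite: McCallumLMS1991, §3 Prop. 3.1, (3); §5 Thm. 5.4] [cite: GrossLMS1991, §5 (5.1), Prop. 5.4, §9 Props. 9.3, 9.6] -/
theorem cebotarev_kernelForm_sylvesterPair_lines {ω : K} (hω : ω ^ 2 + ω + 1 = 0) (h2 : Module.finrank ℚ K = 2)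
    {p : ℕ} (hp : p.Prime) (hp3 : p % 3 = 1) {c : K ≃ₐ[ℚ] K} (hcω : c ω = ω ^ 2) (κ : ℕ) (hκ : 1 ≤ κ)
    (φA : Isogeny ((cubeSumCurve (3 * (p : ℚ) ^ 2)).baseChange K) ((cubeSumCurve (3 * (p : ℚ) ^ 2)).baseChange K))
    (fnA : geomTorsion ((cubeSumCurve (3 * (p : ℚ) ^ 2)).baseChange K) ((2 ^ κ * 2 ^ κ : ℕ) : ℤ) →+
      geomTorsion ((cubeSumCurve (3 * (p : ℚ) ^ 2)).baseChange K) ((2 ^ κ * 2 ^ κ : ℕ) : ℤ))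
    (hfnA : ∀ (g : absoluteGaloisGroup K)
      (Q : geomTorsion ((cubeSumCurve (3 * (p : ℚ) ^ 2)).baseChange K) ((2 ^ κ * 2 ^ κ : ℕ) : ℤ)),
      fnA (ContinuousMonoidHom.id _ g • Q) = g • fnA Q)
    (hφA : ∀ (x y : AlgebraicClosure K)
      (h : (((cubeSumCurve (3 * (p : ℚ) ^ 2)).baseChange K).baseChange (AlgebraicClosure K)).toAffine.Nonsingular x y),
      ∃ h', φA (Affine.Point.some x y h) =
        Affine.Point.some (algebraMap K (AlgebraicClosure K) ω ^ 2 * x) (algebraMap K (AlgebraicClosure K) ω ^ 3 * y) h')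
    (hcoeA : ∀ Q : geomTorsion ((cubeSumCurve (3 * (p : ℚ) ^ 2)).baseChange K) ((2 ^ κ * 2 ^ κ : ℕ) : ℤ),
      ((fnA Q : geomTorsion ((cubeSumCurve (3 * (p : ℚ) ^ 2)).baseChange K) ((2 ^ κ * 2 ^ κ : ℕ) : ℤ)) :
        geomPoints ((cubeSumCurve (3 * (p : ℚ) ^ 2)).baseChange K)) = φA Q)
    (φB : Isogeny ((cubeSumCurve (p : ℚ)).baseChange K) ((cubeSumCurve (p : ℚ)).baseChange K))
    (fnB : geomTorsion ((cubeSumCurve (p : ℚ)).baseChange K) ((2 ^ κ * 2 ^ κ : ℕ) : ℤ) →+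
      geomTorsion ((cubeSumCurve (p : ℚ)).baseChange K) ((2 ^ κ * 2 ^ κ : ℕ) : ℤ))
    (hfnB : ∀ (g : absoluteGaloisGroup K)
      (Q : geomTorsion ((cubeSumCurve (p : ℚ)).baseChange K) ((2 ^ κ * 2 ^ κ : ℕ) : ℤ)),
      fnB (ContinuousMonoidHom.id _ g • Q) = g • fnB Q)
    (hφB : ∀ (x y : AlgebraicClosure K)
      (h : (((cubeSumCurve (p : ℚ)).baseChange K).baseChange (AlgebraicClosure K)).toAffine.Nonsingular x y),
      ∃ h', φB (Affine.Point.some x y h) =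
        Affine.Point.some (algebraMap K (AlgebraicClosure K) ω ^ 2 * x) (algebraMap K (AlgebraicClosure K) ω ^ 3 * y) h')
    (hcoeB : ∀ Q : geomTorsion ((cubeSumCurve (p : ℚ)).baseChange K) ((2 ^ κ * 2 ^ κ : ℕ) : ℤ),
      ((fnB Q : geomTorsion ((cubeSumCurve (p : ℚ)).baseChange K) ((2 ^ κ * 2 ^ κ : ℕ) : ℤ)) :
        geomPoints ((cubeSumCurve (p : ℚ)).baseChange K)) = φB Q)
    {NA NB : ℕ} [NeZero NA] [NeZero NB] (b₀ : ℕ) :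
    ∀ (TA : Finset (galH1Torsion ((cubeSumCurve (3 * (p : ℚ) ^ 2)).baseChange K) ((2 ^ κ * 2 ^ κ : ℕ) : ℤ)))
      (TB : Finset (galH1Torsion ((cubeSumCurve (p : ℚ)).baseChange K) ((2 ^ κ * 2 ^ κ : ℕ) : ℤ)))
      (gA : galH1Torsion ((cubeSumCurve (3 * (p : ℚ) ^ 2)).baseChange K) ((2 ^ κ * 2 ^ κ : ℕ) : ℤ))
      (gB : galH1Torsion ((cubeSumCurve (p : ℚ)).baseChange K) ((2 ^ κ * 2 ^ κ : ℕ) : ℤ)),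
      gA ∈ {x : galH1Torsion ((cubeSumCurve (3 * (p : ℚ) ^ 2)).baseChange K) ((2 ^ κ * 2 ^ κ : ℕ) : ℤ) |
        ∃ y, (∃ ε : ℤ, conjAct (cubeSumCurve (3 * (p : ℚ) ^ 2)) c ((2 ^ κ * 2 ^ κ : ℕ) : ℤ) y = ε • y) ∧
          x ∈ AddSubgroup.closure ({y, resH1Hom (ContinuousMonoidHom.id _) fnA hfnA y} : Set _) ∧
          y ∈ AddSubgroup.closure ({x, resH1Hom (ContinuousMonoidHom.id _) fnA hfnA x} : Set _)} →
      gB ∈ {x : galH1Torsion ((cubeSumCurve (p : ℚ)).baseChange K) ((2 ^ κ * 2 ^ κ : ℕ) : ℤ) |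
        ∃ y, (∃ ε : ℤ, conjAct (cubeSumCurve (p : ℚ)) c ((2 ^ κ * 2 ^ κ : ℕ) : ℤ) y = ε • y) ∧
          x ∈ AddSubgroup.closure ({y, resH1Hom (ContinuousMonoidHom.id _) fnB hfnB y} : Set _) ∧
          y ∈ AddSubgroup.closure ({x, resH1Hom (ContinuousMonoidHom.id _) fnB hfnB x} : Set _)} →
      (↑TA : Set _) ⊆ {x : galH1Torsion ((cubeSumCurve (3 * (p : ℚ) ^ 2)).baseChange K) ((2 ^ κ * 2 ^ κ : ℕ) : ℤ) |
        ∃ y, (∃ ε : ℤ, conjAct (cubeSumCurve (3 * (p : ℚ) ^ 2)) c ((2 ^ κ * 2 ^ κ : ℕ) : ℤ) y = ε • y) ∧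
          x ∈ AddSubgroup.closure ({y, resH1Hom (ContinuousMonoidHom.id _) fnA hfnA y} : Set _) ∧
          y ∈ AddSubgroup.closure ({x, resH1Hom (ContinuousMonoidHom.id _) fnA hfnA x} : Set _)} →
      (↑TB : Set _) ⊆ {x : galH1Torsion ((cubeSumCurve (p : ℚ)).baseChange K) ((2 ^ κ * 2 ^ κ : ℕ) : ℤ) |
        ∃ y, (∃ ε : ℤ, conjAct (cubeSumCurve (p : ℚ)) c ((2 ^ κ * 2 ^ κ : ℕ) : ℤ) y = ε • y) ∧
          x ∈ AddSubgroup.closure ({y, resH1Hom (ContinuousMonoidHom.id _) fnB hfnB y} : Set _) ∧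
          y ∈ AddSubgroup.closure ({x, resH1Hom (ContinuousMonoidHom.id _) fnB hfnB x} : Set _)} → ∀ b : ℕ,
      ∃ ℓ, b < ℓ ∧
        (ℓ.Prime ∧ ¬ ℓ ∣ NA ∧ ¬ ℓ ∣ NB ∧ ¬ ((ℓ : ℤ) ∣ NumberField.discr K) ∧ ℓ ≠ 2 ∧
          (Ideal.span {(ℓ : 𝓞 K)}).IsPrime ∧
          FrobEqFrobInfty (cubeSumCurve (3 * (p : ℚ) ^ 2)) K (2 ^ κ * 2 ^ κ) ℓ ∧
          FrobEqFrobInfty (cubeSumCurve (p : ℚ)) K (2 ^ κ * 2 ^ κ) ℓ ∧ b₀ < ℓ) ∧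
      (∀ g ∈ AddSubgroup.closure (insert gA (insert (resH1Hom (ContinuousMonoidHom.id _) fnA hfnA gA)
          ((TA : Set _) ∪ resH1Hom (ContinuousMonoidHom.id _) fnA hfnA '' (TA : Set _)))),
        (∀ v : HeightOneSpectrum (𝓞 K), (ℓ : 𝓞 K) ∈ v.asIdeal →
          g ∈ ((cubeSumCurve (3 * (p : ℚ) ^ 2)).baseChange K).torsionLocalKer (v.adicCompletion K)
            ((2 ^ κ * 2 ^ κ : ℕ) : ℤ)) ↔
        g ∈ AddSubgroup.closure ((TA : Set _) ∪ resH1Hom (ContinuousMonoidHom.id _) fnA hfnA '' (TA : Set _))) ∧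
      (∀ g ∈ AddSubgroup.closure (insert gB (insert (resH1Hom (ContinuousMonoidHom.id _) fnB hfnB gB)
          ((TB : Set _) ∪ resH1Hom (ContinuousMonoidHom.id _) fnB hfnB '' (TB : Set _)))),
        (∀ v : HeightOneSpectrum (𝓞 K), (ℓ : 𝓞 K) ∈ v.asIdeal →
          g ∈ ((cubeSumCurve (p : ℚ)).baseChange K).torsionLocalKer (v.adicCompletion K)
            ((2 ^ κ * 2 ^ κ : ℕ) : ℤ)) ↔
        g ∈ AddSubgroup.closure ((TB : Set _) ∪ resH1Hom (ContinuousMonoidHom.id _) fnB hfnB '' (TB : Set _))) := by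
  intro TA TB gA gB hgA hgB hTA hTB b
  -- ### `w_X² + w_X + 1 = 0` on `H¹` from the pinned formulas
  have hp2 : p ≠ 2 := by rintro rfl; norm_num at hp3
  have hp0 : (p : ℚ) ≠ 0 := by exact_mod_cast hp.ne_zero
  haveI := Rank1Residual.X12.CubeSumFamilies.isElliptic_cubeSumCurve hp0
  haveI := Rank1Residual.X12.CubeSumFamilies.isElliptic_cubeSumCurve
    (mul_ne_zero (by norm_num) (pow_ne_zero 2 hp0) : (3 * (p : ℚ) ^ 2) ≠ 0)
  have hζ : IsPrimitiveRoot ω 3 := (JZero.exists_aut_apply_eq_sq K hω h2).1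
  have hrelA : ∀ Q, fnA (fnA Q) + fnA Q + Q = 0 := JZero.torsion_hrel_of_formula
    (baseChange_eq_of_a_eq_zero (K := K) (cubeSumCurve (3 * (p : ℚ) ^ 2)) rfl rfl rfl rfl) hζ φA hφA _ fnA hcoeA
  have hrelB : ∀ Q, fnB (fnB Q) + fnB Q + Q = 0 := JZero.torsion_hrel_of_formula
    (baseChange_eq_of_a_eq_zero (K := K) (cubeSumCurve (p : ℚ)) rfl rfl rfl rfl) hζ φB hφB _ fnB hcoeB
  have hwA : ∀ x, resH1Hom (ContinuousMonoidHom.id _) fnA hfnA (resH1Hom (ContinuousMonoidHom.id _) fnA hfnA x) +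
      resH1Hom (ContinuousMonoidHom.id _) fnA hfnA x + x = 0 := resH1Hom_id_apply_apply_add _ fnA hfnA hrelA
  have hwB : ∀ x, resH1Hom (ContinuousMonoidHom.id _) fnB hfnB (resH1Hom (ContinuousMonoidHom.id _) fnB hfnB x) +
      resH1Hom (ContinuousMonoidHom.id _) fnB hfnB x + x = 0 := resH1Hom_id_apply_apply_add _ fnB hfnB hrelB
  -- ### eigen partners
  obtain ⟨yA, hyA, hgAy, hyAg⟩ := hgA
  obtain ⟨yB, hyB, hgBy, hyBg⟩ := hgB
  obtain ⟨TA', hTA', hTT'A, hT'TA⟩ := exists_partners_finset _ hwA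
    (fun x ↦ ∃ ε : ℤ, conjAct (cubeSumCurve (3 * (p : ℚ) ^ 2)) c ((2 ^ κ * 2 ^ κ : ℕ) : ℤ) x = ε • x) TA
    (fun t ht ↦ hTA (Finset.mem_coe.mpr ht))
  obtain ⟨TB', hTB', hTT'B, hT'TB⟩ := exists_partners_finset _ hwB
    (fun x ↦ ∃ ε : ℤ, conjAct (cubeSumCurve (p : ℚ)) c ((2 ^ κ * 2 ^ κ : ℕ) : ℤ) x = ε • x) TB
    (fun t ht ↦ hTB (Finset.mem_coe.mpr ht))
  -- ### (T-L3) for the partners, then transfer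
  obtain ⟨ℓ, hbℓ, hKol, hKFA, hKFB⟩ := cebotarev_kernelForm_sylvesterPair (NA := NA) (NB := NB) hω h2 hp hp3 hcω κ hκ
    φA fnA hfnA hφA hcoeA φB fnB hfnB hφB hcoeB b₀ TA' TB' yA yB hyA hyB (fun t ht ↦ hTA' t (Finset.mem_coe.mp ht))
    (fun t ht ↦ hTB' t (Finset.mem_coe.mp ht)) b
  exact ⟨ℓ, hbℓ, hKol,
    kernelForm_of_partners _ hwA _ hgAy hyAg hTT'A hT'TA hKFA,
    kernelForm_of_partners _ hwB _ hgBy hyBg hTT'B hT'TB hKFB⟩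

end Summit.BirchSwinnertonDyer.BirchSwinnertonDyer.Theorems.SylvesterTwoCoupledTelescope

end
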